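import Mathlib
import Summits.Ventures.HodgeRepro.Tier4.Target
import Summits.Ventures.HodgeRepro.Tier4.Line3.Defs
import Summits.Ventures.HodgeRepro.Tier4.Line3.KMDatum
import Summits.Ventures.HodgeRepro.Tier4.Line3.Majorant
import Summits.Ventures.HodgeRepro.Tier4.Line3.Denominator
import Summits.Ventures.HodgeRepro.Tier4.Line3.OffMainOrbit
import Summits.Ventures.HodgeRepro.Tier4.Line3.LatticeGaussDefs

/-!
# Tier4/Line3/LatticeEmbedLemmas — the discreteness of a lattice under the archimedean embedding (rung for (R2))

Blind re-derivation cell `pub-hodge-repro`, Tier 4 «PROVE THE STEP» (README §9–§10), LINE L3, seat t4-x2 (reserve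
wall-breaker) on (R2) THE LATTICE GAUSSIAN SUM of L3.5's residual (lead g385 S12860 (R-IV); L2-p1's census S12833).

`embV v = (σ (v i))_{σ, i}` (LatticeGaussDefs) embeds `E′³` into the finite-dimensional real normed space `(E′ →+* ℂ) → Fin 3 → ℂ`
(sup norm); it is injective and additive.  For a finitely generated `𝒪_{E′}`-submodule `L ⊆ E′³` the image `latt L` is a
`ℤ`-submodule, and it is DISCRETE: the coordinates of `L` have a common denominator `D₀` (`Denominator.exists_denom_smul_mem`
on the three coordinate projections), and a non-zero algebraic integer has absolute value `≥ 1` at some embedding (the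
landed product-formula rung `Majorant.rung_archimedean_size` at depth `0`), so `‖embV v‖ ≥ 1 / Σ_σ ‖σ D₀‖` for every
`v ∈ L ∖ {0}` (`DiscreteTopology.of_forall_le_norm`).  This is what Mathlib's `ZLattice.summable_norm_rpow` needs.

Nothing here asserts anything about the truth of (P); HC_CM is NOT proved by anyone in this repository.
-/

set_option autoImplicit false

noncomputable section

namespace Summit.Ventures.HodgeRepro.Tier4.Line3

open Matrix NumberField

namespace T4Data

variable (X : T4Data)

/-- The coordinate of `embV v` at `(σ, i)` is bounded by the norm. -/
theorem norm_apply_le_norm_embV (v : Fin 3 → X.E) (σ : X.E →+* ℂ) (i : Fin 3) : ‖σ (v i)‖ ≤ ‖X.embV v‖ :=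
  (norm_le_pi_norm (X.embV v σ) i).trans (norm_le_pi_norm (X.embV v) σ)

/-- The norm of `embV v` is bounded by any bound on all coordinates. -/
theorem norm_embV_le {v : Fin 3 → X.E} {r : ℝ} (hr : 0 ≤ r) (h : ∀ (σ : X.E →+* ℂ) (i : Fin 3), ‖σ (v i)‖ ≤ r) :
    ‖X.embV v‖ ≤ r :=
  (pi_norm_le_iff_of_nonneg hr).mpr fun σ => (pi_norm_le_iff_of_nonneg hr).mpr fun i => h σ i

/-- **A COMMON DENOMINATOR of the coordinates** of a finitely generated `𝒪_{E′}`-submodule of `E′³`. -/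
theorem exists_denom_coord {L : Submodule (RingOfIntegers X.E) (Fin 3 → X.E)} (hL : L.FG) :
    ∃ D₀ : RingOfIntegers X.E, D₀ ≠ 0 ∧ ∀ v ∈ L, ∀ i : Fin 3,
      ∃ β : RingOfIntegers X.E, (β : X.E) = (D₀ : X.E) * v i := by
  -- the three coordinate projections are finitely generated submodules of `E′`
  have hproj : ∀ i : Fin 3, (L.map (LinearMap.proj i : (Fin 3 → X.E) →ₗ[RingOfIntegers X.E] X.E)).FG :=
    fun i => hL.map _
  obtain ⟨D₀, hD₀, hden⟩ := exists_denom_finset (Finset.univ : Finset (Fin 3))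
    (fun i => L.map (LinearMap.proj i : (Fin 3 → X.E) →ₗ[RingOfIntegers X.E] X.E)) fun i _ => hproj i
  refine ⟨D₀, hD₀, fun v hv i => ?_⟩
  have hmem : v i ∈ (⊤ : Ideal (RingOfIntegers X.E)) •
      L.map (LinearMap.proj i : (Fin 3 → X.E) →ₗ[RingOfIntegers X.E] X.E) := by
    rw [Submodule.top_smul]
    exact Submodule.mem_map_of_mem hv
  obtain ⟨β, _, hβ⟩ := hden i (Finset.mem_univ i) ⊤ (v i) hmem
  refine ⟨β, ?_⟩
  have h' : (β : X.E) = (D₀ : X.E) * v i := by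
    have := hβ
    rwa [Algebra.smul_def] at this
  exact h'

/-- `Σ_σ ‖σ D₀‖ > 0` for `D₀ ≠ 0`. -/
theorem sum_norm_emb_pos {D₀ : RingOfIntegers X.E} (hD₀ : D₀ ≠ 0) : 0 < ∑ σ : X.E →+* ℂ, ‖σ (D₀ : X.E)‖ := by
  have hne : (D₀ : X.E) ≠ 0 := RingOfIntegers.coe_ne_zero_iff.mpr hD₀
  refine Finset.sum_pos' (fun σ _ => norm_nonneg _) ⟨X.τ₀, Finset.mem_univ _, ?_⟩
  rw [norm_pos_iff]
  exact (map_ne_zero X.τ₀).mpr hne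

/-- **NON-ZERO LATTICE VECTORS ARE NOT SMALL**: for `v ∈ L ∖ {0}`, `‖embV v‖ ≥ 1 / Σ_σ ‖σ D₀‖` (a non-zero integral
coordinate `D₀ v_i` has absolute value `≥ 1` at some embedding: the product-formula rung at depth `0`). -/
theorem norm_embV_ge (p : IsDedekindDomain.HeightOneSpectrum (RingOfIntegers X.E))
    {L : Submodule (RingOfIntegers X.E) (Fin 3 → X.E)} (hL : L.FG) :
    ∃ r : ℝ, 0 < r ∧ ∀ v ∈ L, v ≠ 0 → r ≤ ‖X.embV v‖ := by
  obtain ⟨D₀, hD₀, hden⟩ := X.exists_denom_coord hL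
  have hB := X.sum_norm_emb_pos hD₀
  refine ⟨(∑ σ : X.E →+* ℂ, ‖σ (D₀ : X.E)‖)⁻¹, inv_pos.mpr hB, fun v hv hv0 => ?_⟩
  -- a non-zero coordinate
  obtain ⟨i, hi⟩ : ∃ i, v i ≠ 0 := by
    by_contra hall
    exact hv0 (funext fun i => by_contra fun h => hall ⟨i, h⟩)
  obtain ⟨β, hβ⟩ := hden v hv i
  have hβ0 : β ≠ 0 := by
    intro h0
    rw [h0] at hβ
    have : (D₀ : X.E) * v i = 0 := by rw [← hβ]; simp
    rcases mul_eq_zero.mp this with h | h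
    · exact hD₀ (RingOfIntegers.coe_eq_zero_iff.mp h)
    · exact hi h
  obtain ⟨σ, hσ⟩ := rung_archimedean_size X.E p 0 β (by simp) hβ0
  rw [pow_zero] at hσ
  have hd : 0 < Module.finrank ℚ X.E := Module.finrank_pos
  have h1 : 1 ≤ ‖σ β‖ := by
    refine le_of_not_gt fun hlt => ?_
    have := pow_lt_one₀ (norm_nonneg _) hlt hd.ne'
    linarith
  have h2 : ‖σ β‖ = ‖σ (D₀ : X.E)‖ * ‖σ (v i)‖ := by
    rw [← norm_mul, ← map_mul, ← hβ]
  have h3 : ‖σ (D₀ : X.E)‖ ≤ ∑ σ' : X.E →+* ℂ, ‖σ' (D₀ : X.E)‖ :=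
    Finset.single_le_sum (f := fun σ' : X.E →+* ℂ => ‖σ' (D₀ : X.E)‖) (fun _ _ => norm_nonneg _)
      (Finset.mem_univ σ)
  have h4 : ‖σ (v i)‖ ≤ ‖X.embV v‖ := X.norm_apply_le_norm_embV v σ i
  rw [inv_le_iff_one_le_mul₀' hB]
  calc (1 : ℝ) ≤ ‖σ β‖ := h1
    _ = ‖σ (D₀ : X.E)‖ * ‖σ (v i)‖ := h2
    _ ≤ (∑ σ' : X.E →+* ℂ, ‖σ' (D₀ : X.E)‖) * ‖X.embV v‖ :=
        mul_le_mul h3 h4 (norm_nonneg _) hB.le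

/-- **THE LATTICE IS DISCRETE** in `(E′ →+* ℂ) → Fin 3 → ℂ`. -/
theorem discreteTopology_latt (p : IsDedekindDomain.HeightOneSpectrum (RingOfIntegers X.E))
    {L : Submodule (RingOfIntegers X.E) (Fin 3 → X.E)} (hL : L.FG) : DiscreteTopology (X.latt L) := by
  obtain ⟨r, hr, h⟩ := X.norm_embV_ge p hL
  refine DiscreteTopology.of_forall_le_norm hr fun x hx => ?_
  obtain ⟨v, hv, hvx⟩ := X.mem_latt.mp x.2
  have hv0 : v ≠ 0 := by
    intro h0
    apply hx
    apply Subtype.ext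
    rw [← hvx, h0]
    exact map_zero X.embAdd
  have := h v hv hv0
  rw [hvx] at this
  exact this

end T4Data

end Summit.Ventures.HodgeRepro.Tier4.Line3

end
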